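import Summits.BirchSwinnertonDyer.BirchSwinnertonDyer.Theorems.ByReductionTypeAtTwoMultUpperHalfTowerNS2TwoBitKernel
import Summits.BirchSwinnertonDyer.BirchSwinnertonDyer.Theorems.ByReductionTypeAtTwoMultUpperHalfTowerNS2OneBitKernel
import Summits.BirchSwinnertonDyer.BirchSwinnertonDyer.Theorems.ByReductionTypeAtTwoMultUpperHalfTowerSplitOneBitKernel
import Summits.BirchSwinnertonDyer.BirchSwinnertonDyer.Theorems.ByReductionTypeAtTwoMultUpperHalfTowerSplitZeroBitKernel
import Literature.NumberTheory.EllipticCurves.Greenberg1999.ControlLocalKernelsLayerGoodProofs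
import Literature.NumberTheory.EllipticCurves.Greenberg1999.ControlLocalKernelsLayerMultiplicativeProofs
import Literature.NumberTheory.EllipticCurves.Greenberg1999.ControlLocalKernelsLayerAdditiveProofs
import Literature.NumberTheory.EllipticCurves.Greenberg1999.CyclotomicTorsionFiniteHolds
import HarnessLib

/-!
# Route `ByReductionTypeAtTwo`, crux `MultUpperHalfAtTwo` (item stmt-BirchSwinnertonDyer-19922): the TOWER-gap doors at a MULTIPLICATIVE `2`
# with EVERY local binder discharged by tree theorems — `O1.TowerGapAtTwo W` from decidable curve data + the two layer Selmer counts ONLY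

HONEST FRAMING (cell `bsd-2adic`, run/shared/lean/pub/bsd-2adic/, seat `bsd-2adic-tower-1` GEN 10, HUMAN RULINGS D-0036 / D-0054 / D-0074):
research route; THEOREMS ONLY; nothing is booked; BSD is not proved by any of this. The cell's multiplicative-at-`2` TOWER doors display four
kinds of PRINT/MEMO binders on the local tower kernels `𝒦_{v,n}[2^∞]`: at the odd primes `h33g`/`hM`/`hA` (Greenberg LNM 1716 Lemma 3.3 read at
`p = 2`), and at `v ∣ 2` one of `hNS2` / `hNS2one` / `hSP` (+ Tate certificate) / `hSP1`. ALL of them are now tree theorems: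
`Greenberg1999.lemma33_localTowerKerPrimary_eq_bot_of_good_holds`, `…_cyclic_of_multiplicative_holds`, `…_le_four_of_additive_holds`
(Literature, `ControlLocalKernelsLayer{Good,Multiplicative,Additive}Proofs.lean`), and at `v ∣ 2` this seat's
`MultTowerNS2.twoTorsion_localTowerKerPrimary_le_four_nonsplitTwo` (two bits, every non-split `2`),
`MultTowerNS2.localTowerKerTwoTorsion_le_two_nonsplitTwo_of_tateUnit_holds` (one bit, non-split, Tate unit `≡ ±3 (mod 8)`, GEN 9),
`MultTowerSP1.sec3_natCard_pTorsion_localTowerKerPrimary_le_splitMultiplicative_rat_holds` (one bit, every split `2`),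
`MultTowerSP1.twoTorsion_localTowerKerPrimary_le_one_splitTwo_of_tateUnit` (zero bits, split, Tate unit `≡ ±3 (mod 8)`); and `hBtors` is
`Greenberg1999.finite_torsion_cyclotomicZpExtension_holds`. This file composes them: each door below concludes `O1.TowerGapAtTwo W` from
DECIDABLE per-curve data (reduction types, `Δ_min`, `c₄`, torsion order or a good-prime point count, the finite set `P` with its local constants) and
the two LAYER SELMER COUNTS `hlow`/`hup` (kit certificates, displayed) with the closed arithmetic `harith` — and NOTHING ELSE. What these doors do
NOT do: prove the layer counts, or the crux `MultUpperHalfAtTwo` (the Kato/descent side of the class files is untouched).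
References: R. Greenberg, LNM 1716 (1999) §§1, 3, 4; J. Silverman, GTM 106 VII, GTM 151 IV–V; cell memos NOTE-SP1ONE.md, PROOF-NS2ONE.md.
-/

set_option autoImplicit false
-- the Theorems namespace of this sub repeats the summit name by design (D-0017 nested layout: Summit.<S>.<Sub>)
set_option linter.dupNamespace false

noncomputable section

open scoped Classical

open NumberField IsDedekindDomain WeierstrassCurve Literature.NumberTheory.EllipticCurves
  Literature.NumberTheory.EllipticCurves.Greenberg1999
  Summit.BirchSwinnertonDyer.Rank1Residual.X5 Summit.BirchSwinnertonDyer.Rank1Residual.X5.O1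
  Summit.BirchSwinnertonDyer.Rank1Residual

namespace Summit.BirchSwinnertonDyer.BirchSwinnertonDyer.Theorems.MultTowerKernel

variable (W : WeierstrassCurve ℚ) [W.IsElliptic] [W.IsGloballyMinimal]

/-! ### Odd torsion order (`E[2]` irreducible members): layer pair `j ≤ j'` -/

/-- **TOWER gap at a NON-SPLIT multiplicative `2`, TWO bits, every local binder discharged**: odd torsion order, layer counts at `j ≤ j'`,
arithmetic `2^d · 4 · ∏_{ℓ ∈ P} C_ℓ^{2^{min(j', e_ℓ)}} < 2^{2^{j'} − 2^j + a}` ⟹ `O1.TowerGapAtTwo W`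
(= `MultTowerCert.towerGapAtTwo_of_layerSelmer_cert_nonsplitTwo_kernel` fed with the three Lemma-3.3 theorems).
[cite: GreenbergLNM1716, §3 Lemmas 3.3–3.5 (PDF pp. 86–90) and pp. 90–93] [cite: SilvermanAEC2009, VII.1 Prop. 1.3, VII.5.1] -/
theorem towerGapAtTwo_of_layerSelmer_cert_nonsplitTwo
    (hmult : W.HasMultiplicativeReductionAtPrime 2) (hns : ¬ W.HasSplitMultiplicativeReductionAtPrime 2)
    (htors : ¬ 2 ∣ W.torsionOrder) {j j' a d : ℕ} (hjj' : j ≤ j')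
    (P : Finset ℕ) (hP : ∀ ℓ ∈ P, ℓ.Prime ∧ ℓ ≠ 2)
    (hΔ : ∀ ℓ : ℕ, ℓ.Prime → ℓ ≠ 2 → (ℓ : ℤ) ∣ W.minimalDiscriminantInt → ℓ ∈ P)
    (C e k : ℕ → ℕ) (he : ∀ ℓ ∈ P, ¬ 2 ^ (e ℓ + 4) ∣ ℓ ^ 2 - 1)
    (hC : ∀ (ℓ : ℕ) [Fact ℓ.Prime], ℓ ∈ P →
      4 ≤ C ℓ ∨ (W.HasMultiplicativeReductionAtPrime ℓ ∧ 2 ≤ C ℓ) ∨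
        (W.HasMultiplicativeReductionAtPrime ℓ ∧ (ℓ : ℤ) ^ k ℓ ∣ W.minimalDiscriminantInt ∧
          ¬ (ℓ : ℤ) ^ (k ℓ + 1) ∣ W.minimalDiscriminantInt ∧ ¬ 2 ∣ k ℓ ∧ 1 ≤ C ℓ) ∨
        (¬ (ℓ : ℤ) ∣ W.minimalDiscriminantInt ∧ 1 ≤ C ℓ))
    (hlow : ∀ κ : ZpExtension ℚ 2, κ.IsCyclotomic →
      2 ^ a ≤ Nat.card {z : W.selmerLayer κ j // 2 • z = 0})
    (hup : ∀ κ : ZpExtension ℚ 2, κ.IsCyclotomic →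
      Nat.card {z : W.selmerLayer κ j' // 2 • z = 0} ≤ 2 ^ d)
    (harith : 2 ^ d * 4 * ∏ ℓ ∈ P, C ℓ ^ 2 ^ min j' (e ℓ) < 2 ^ (2 ^ j' - 2 ^ j + a)) :
    TowerGapAtTwo W :=
  MultTowerCert.towerGapAtTwo_of_layerSelmer_cert_nonsplitTwo_kernel W lemma33_localTowerKerPrimary_eq_bot_of_good_holds
    lemma33_localTowerKerPrimary_cyclic_of_multiplicative_holds lemma33_natCard_localTowerKerPrimary_le_four_of_additive_holds
    hmult hns htors hjj' P hP hΔ C e k he hC hlow hup harith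

/-- **TOWER gap at a NON-SPLIT multiplicative `2` with Tate unit `≡ ±3 (mod 8)`, ONE bit, every local binder discharged**: odd torsion order,
layer counts at `j ≤ j'`, `1 ≤ j'`, arithmetic `2^d · 2 · ∏_{ℓ ∈ P} C_ℓ^{2^{min(j', e_ℓ)}} < 2^{2^{j'} − 2^j + a}` ⟹ `O1.TowerGapAtTwo W`
(= `MultTowerNS2.towerGapAtTwo_of_layerSelmer_cert_nonsplitTwo_oneBit_kernel` fed with the three Lemma-3.3 theorems).
[cite: GreenbergLNM1716, §3 Lemmas 3.3–3.5 (PDF pp. 86–90) and pp. 90–93] [cite: SilvermanAEC2009, VII.1 Prop. 1.3, VII.5.1] -/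
theorem towerGapAtTwo_of_layerSelmer_cert_nonsplitTwo_oneBit
    (hmult : W.HasMultiplicativeReductionAtPrime 2) (hns : ¬ W.HasSplitMultiplicativeReductionAtPrime 2)
    (hq : ∃ (k : ℕ) (u c : ℤ), W.minimalDiscriminantInt = 2 ^ k * u ∧ W.c₄ = (c : ℚ) ∧ (u * c % 8 = 3 ∨ u * c % 8 = 5))
    (htors : ¬ 2 ∣ W.torsionOrder) {j j' a d : ℕ} (hjj' : j ≤ j') (hj' : 1 ≤ j')
    (P : Finset ℕ) (hP : ∀ ℓ ∈ P, ℓ.Prime ∧ ℓ ≠ 2)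
    (hΔ : ∀ ℓ : ℕ, ℓ.Prime → ℓ ≠ 2 → (ℓ : ℤ) ∣ W.minimalDiscriminantInt → ℓ ∈ P)
    (C e k : ℕ → ℕ) (he : ∀ ℓ ∈ P, ¬ 2 ^ (e ℓ + 4) ∣ ℓ ^ 2 - 1)
    (hC : ∀ (ℓ : ℕ) [Fact ℓ.Prime], ℓ ∈ P →
      4 ≤ C ℓ ∨ (W.HasMultiplicativeReductionAtPrime ℓ ∧ 2 ≤ C ℓ) ∨
        (W.HasMultiplicativeReductionAtPrime ℓ ∧ (ℓ : ℤ) ^ k ℓ ∣ W.minimalDiscriminantInt ∧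
          ¬ (ℓ : ℤ) ^ (k ℓ + 1) ∣ W.minimalDiscriminantInt ∧ ¬ 2 ∣ k ℓ ∧ 1 ≤ C ℓ) ∨
        (¬ (ℓ : ℤ) ∣ W.minimalDiscriminantInt ∧ 1 ≤ C ℓ))
    (hlow : ∀ κ : ZpExtension ℚ 2, κ.IsCyclotomic →
      2 ^ a ≤ Nat.card {z : W.selmerLayer κ j // 2 • z = 0})
    (hup : ∀ κ : ZpExtension ℚ 2, κ.IsCyclotomic →
      Nat.card {z : W.selmerLayer κ j' // 2 • z = 0} ≤ 2 ^ d)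
    (harith : 2 ^ d * 2 * ∏ ℓ ∈ P, C ℓ ^ 2 ^ min j' (e ℓ) < 2 ^ (2 ^ j' - 2 ^ j + a)) :
    TowerGapAtTwo W :=
  MultTowerNS2.towerGapAtTwo_of_layerSelmer_cert_nonsplitTwo_oneBit_kernel W lemma33_localTowerKerPrimary_eq_bot_of_good_holds
    lemma33_localTowerKerPrimary_cyclic_of_multiplicative_holds lemma33_natCard_localTowerKerPrimary_le_four_of_additive_holds
    hmult hns hq htors hjj' hj' P hP hΔ C e k he hC hlow hup harith

/-- **TOWER gap at a SPLIT multiplicative `2`, ONE bit, every local binder discharged**: odd torsion order, layer counts at `j ≤ j'`, arithmetic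
`2^d · 2 · ∏_{ℓ ∈ P} C_ℓ^{2^{min(j', e_ℓ)}} < 2^{2^{j'} − 2^j + a}` ⟹ `O1.TowerGapAtTwo W`
(= `MultTowerCert.towerGapAtTwo_of_layerSelmer_cert_splitTwo_oneBit_kernel` fed with the three Lemma-3.3 theorems).
[cite: GreenbergLNM1716, §3 Lemmas 3.3–3.5 (PDF pp. 86–90) and pp. 90–93] [cite: SilvermanAEC2009, VII.1 Prop. 1.3, VII.5.1] -/
theorem towerGapAtTwo_of_layerSelmer_cert_splitTwo_oneBit
    (hsplit : W.HasSplitMultiplicativeReductionAtPrime 2)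
    (htors : ¬ 2 ∣ W.torsionOrder) {j j' a d : ℕ} (hjj' : j ≤ j')
    (P : Finset ℕ) (hP : ∀ ℓ ∈ P, ℓ.Prime ∧ ℓ ≠ 2)
    (hΔ : ∀ ℓ : ℕ, ℓ.Prime → ℓ ≠ 2 → (ℓ : ℤ) ∣ W.minimalDiscriminantInt → ℓ ∈ P)
    (C e k : ℕ → ℕ) (he : ∀ ℓ ∈ P, ¬ 2 ^ (e ℓ + 4) ∣ ℓ ^ 2 - 1)
    (hC : ∀ (ℓ : ℕ) [Fact ℓ.Prime], ℓ ∈ P →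
      4 ≤ C ℓ ∨ (W.HasMultiplicativeReductionAtPrime ℓ ∧ 2 ≤ C ℓ) ∨
        (W.HasMultiplicativeReductionAtPrime ℓ ∧ (ℓ : ℤ) ^ k ℓ ∣ W.minimalDiscriminantInt ∧
          ¬ (ℓ : ℤ) ^ (k ℓ + 1) ∣ W.minimalDiscriminantInt ∧ ¬ 2 ∣ k ℓ ∧ 1 ≤ C ℓ) ∨
        (¬ (ℓ : ℤ) ∣ W.minimalDiscriminantInt ∧ 1 ≤ C ℓ))
    (hlow : ∀ κ : ZpExtension ℚ 2, κ.IsCyclotomic →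
      2 ^ a ≤ Nat.card {z : W.selmerLayer κ j // 2 • z = 0})
    (hup : ∀ κ : ZpExtension ℚ 2, κ.IsCyclotomic →
      Nat.card {z : W.selmerLayer κ j' // 2 • z = 0} ≤ 2 ^ d)
    (harith : 2 ^ d * 2 * ∏ ℓ ∈ P, C ℓ ^ 2 ^ min j' (e ℓ) < 2 ^ (2 ^ j' - 2 ^ j + a)) :
    TowerGapAtTwo W :=
  MultTowerCert.towerGapAtTwo_of_layerSelmer_cert_splitTwo_oneBit_kernel W lemma33_localTowerKerPrimary_eq_bot_of_good_holds
    lemma33_localTowerKerPrimary_cyclic_of_multiplicative_holds lemma33_natCard_localTowerKerPrimary_le_four_of_additive_holds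
    hsplit htors hjj' P hP hΔ C e k he hC hlow hup harith

/-- **TOWER gap at a SPLIT multiplicative `2` with Tate unit `≡ ±3 (mod 8)`, ZERO bits, every local binder discharged**: odd torsion order, layer
counts at `j ≤ j'`, arithmetic `2^d · ∏_{ℓ ∈ P} C_ℓ^{2^{min(j', e_ℓ)}} < 2^{2^{j'} − 2^j + a}` ⟹ `O1.TowerGapAtTwo W`
(= `MultTowerCert.towerGapAtTwo_of_layerSelmer_cert_splitTwo_zeroBit_kernel` fed with the three Lemma-3.3 theorems).
[cite: GreenbergLNM1716, §3 Lemmas 3.3–3.5 (PDF pp. 86–90) and pp. 90–93] [cite: SilvermanAEC2009, VII.1 Prop. 1.3, VII.5.1] -/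
theorem towerGapAtTwo_of_layerSelmer_cert_splitTwo_zeroBit
    (hsplit : W.HasSplitMultiplicativeReductionAtPrime 2)
    (htu : ∃ (k : ℕ) (u c : ℤ), W.minimalDiscriminantInt = 2 ^ k * u ∧ W.c₄ = (c : ℚ) ∧ (u * c % 8 = 3 ∨ u * c % 8 = 5))
    (htors : ¬ 2 ∣ W.torsionOrder) {j j' a d : ℕ} (hjj' : j ≤ j')
    (P : Finset ℕ) (hP : ∀ ℓ ∈ P, ℓ.Prime ∧ ℓ ≠ 2)
    (hΔ : ∀ ℓ : ℕ, ℓ.Prime → ℓ ≠ 2 → (ℓ : ℤ) ∣ W.minimalDiscriminantInt → ℓ ∈ P)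
    (C e k : ℕ → ℕ) (he : ∀ ℓ ∈ P, ¬ 2 ^ (e ℓ + 4) ∣ ℓ ^ 2 - 1)
    (hC : ∀ (ℓ : ℕ) [Fact ℓ.Prime], ℓ ∈ P →
      4 ≤ C ℓ ∨ (W.HasMultiplicativeReductionAtPrime ℓ ∧ 2 ≤ C ℓ) ∨
        (W.HasMultiplicativeReductionAtPrime ℓ ∧ (ℓ : ℤ) ^ k ℓ ∣ W.minimalDiscriminantInt ∧
          ¬ (ℓ : ℤ) ^ (k ℓ + 1) ∣ W.minimalDiscriminantInt ∧ ¬ 2 ∣ k ℓ ∧ 1 ≤ C ℓ) ∨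
        (¬ (ℓ : ℤ) ∣ W.minimalDiscriminantInt ∧ 1 ≤ C ℓ))
    (hlow : ∀ κ : ZpExtension ℚ 2, κ.IsCyclotomic →
      2 ^ a ≤ Nat.card {z : W.selmerLayer κ j // 2 • z = 0})
    (hup : ∀ κ : ZpExtension ℚ 2, κ.IsCyclotomic →
      Nat.card {z : W.selmerLayer κ j' // 2 • z = 0} ≤ 2 ^ d)
    (harith : 2 ^ d * ∏ ℓ ∈ P, C ℓ ^ 2 ^ min j' (e ℓ) < 2 ^ (2 ^ j' - 2 ^ j + a)) :
    TowerGapAtTwo W :=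
  MultTowerCert.towerGapAtTwo_of_layerSelmer_cert_splitTwo_zeroBit_kernel W lemma33_localTowerKerPrimary_eq_bot_of_good_holds
    lemma33_localTowerKerPrimary_cyclic_of_multiplicative_holds lemma33_natCard_localTowerKerPrimary_le_four_of_additive_holds
    hsplit htu htors hjj' P hP hΔ C e k he hC hlow hup harith

/-! ### Any torsion (lower layer `ℚ`, torsion bounded at a good prime `ℓ₀ ≥ 3`) -/

/-- **TOWER gap at a NON-SPLIT multiplicative `2`, TWO bits, any rational torsion, every local binder discharged**: torsion count from a good prime
`ℓ₀ ≥ 3` (`#Ẽ(𝔽_{ℓ₀}) = n`, `¬ 2^{t+1} ∣ n`), layer counts at `0 ≤ j'`, arithmetic `2^{d+t} · 4 · ∏_{ℓ∈P} C_ℓ^{2^{min(j', e_ℓ)}} < 2^{2^{j'} − 1 + a}`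
(= `MultTowerTorsion.towerGapAtTwo_of_layerSelmer_cert_nonsplitTwo_of_goodPrime_kernel` fed with the Lemma-3.3 theorems and
`Greenberg1999.finite_torsion_cyclotomicZpExtension_holds`).
[cite: GreenbergLNM1716, §1 p. 62, §3 pp. 85–94, §4 Lemma 4.3] [cite: SilvermanAEC2009, VII.3 Prop. 3.1(b), VII.5.1]
[cite: Ribet1981KatzLangAppendix, Theorem (p. 315)] -/
theorem towerGapAtTwo_of_layerSelmer_cert_nonsplitTwo_of_goodPrime
    (hmult : W.HasMultiplicativeReductionAtPrime 2) (hns : ¬ W.HasSplitMultiplicativeReductionAtPrime 2)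
    (ℓ₀ : ℕ) [Fact ℓ₀.Prime] (h3 : 3 ≤ ℓ₀) (hgood : W.HasGoodReductionAtPrime ℓ₀) {t n : ℕ}
    (hn : W.reductionPointCount ℓ₀ = n) (hndvd : ¬ 2 ^ (t + 1) ∣ n) {j' a d : ℕ}
    (P : Finset ℕ) (hP : ∀ ℓ ∈ P, ℓ.Prime ∧ ℓ ≠ 2)
    (hΔ : ∀ ℓ : ℕ, ℓ.Prime → ℓ ≠ 2 → (ℓ : ℤ) ∣ W.minimalDiscriminantInt → ℓ ∈ P)
    (C e k : ℕ → ℕ) (he : ∀ ℓ ∈ P, ¬ 2 ^ (e ℓ + 4) ∣ ℓ ^ 2 - 1)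
    (hC : ∀ (ℓ : ℕ) [Fact ℓ.Prime], ℓ ∈ P →
      4 ≤ C ℓ ∨ (W.HasMultiplicativeReductionAtPrime ℓ ∧ 2 ≤ C ℓ) ∨
        (W.HasMultiplicativeReductionAtPrime ℓ ∧ (ℓ : ℤ) ^ k ℓ ∣ W.minimalDiscriminantInt ∧
          ¬ (ℓ : ℤ) ^ (k ℓ + 1) ∣ W.minimalDiscriminantInt ∧ ¬ 2 ∣ k ℓ ∧ 1 ≤ C ℓ) ∨
        (¬ (ℓ : ℤ) ∣ W.minimalDiscriminantInt ∧ 1 ≤ C ℓ))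
    (hlow : ∀ κ : ZpExtension ℚ 2, κ.IsCyclotomic →
      2 ^ a ≤ Nat.card {z : W.selmerLayer κ 0 // 2 • z = 0})
    (hup : ∀ κ : ZpExtension ℚ 2, κ.IsCyclotomic →
      Nat.card {z : W.selmerLayer κ j' // 2 • z = 0} ≤ 2 ^ d)
    (harith : 2 ^ (d + t) * 4 * ∏ ℓ ∈ P, C ℓ ^ 2 ^ min j' (e ℓ) < 2 ^ (2 ^ j' - 1 + a)) :
    TowerGapAtTwo W :=
  MultTowerTorsion.towerGapAtTwo_of_layerSelmer_cert_nonsplitTwo_of_goodPrime_kernel W lemma33_localTowerKerPrimary_eq_bot_of_good_holds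
    lemma33_localTowerKerPrimary_cyclic_of_multiplicative_holds lemma33_natCard_localTowerKerPrimary_le_four_of_additive_holds
    hmult hns finite_torsion_cyclotomicZpExtension_holds ℓ₀ h3 hgood hn hndvd P hP hΔ C e k he hC hlow hup harith

/-- **TOWER gap at a SPLIT multiplicative `2`, ONE bit, any rational torsion, every local binder discharged**: torsion count from a good prime
`ℓ₀ ≥ 3`, layer counts at `0 ≤ j'`, arithmetic `2^{d+t} · 2 · ∏_{ℓ∈P} C_ℓ^{2^{min(j', e_ℓ)}} < 2^{2^{j'} − 1 + a}`
(= `MultTowerTorsion.towerGapAtTwo_of_layerSelmer_cert_splitTwo_oneBit_of_goodPrime_kernel` fed with the Lemma-3.3 theorems and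
`Greenberg1999.finite_torsion_cyclotomicZpExtension_holds`).
[cite: GreenbergLNM1716, §1 p. 62, §3 pp. 85–94, §4 Lemma 4.3] [cite: SilvermanAEC2009, VII.3 Prop. 3.1(b), VII.5.1]
[cite: Ribet1981KatzLangAppendix, Theorem (p. 315)] -/
theorem towerGapAtTwo_of_layerSelmer_cert_splitTwo_oneBit_of_goodPrime
    (hsplit : W.HasSplitMultiplicativeReductionAtPrime 2)
    (ℓ₀ : ℕ) [Fact ℓ₀.Prime] (h3 : 3 ≤ ℓ₀) (hgood : W.HasGoodReductionAtPrime ℓ₀) {t n : ℕ}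
    (hn : W.reductionPointCount ℓ₀ = n) (hndvd : ¬ 2 ^ (t + 1) ∣ n) {j' a d : ℕ}
    (P : Finset ℕ) (hP : ∀ ℓ ∈ P, ℓ.Prime ∧ ℓ ≠ 2)
    (hΔ : ∀ ℓ : ℕ, ℓ.Prime → ℓ ≠ 2 → (ℓ : ℤ) ∣ W.minimalDiscriminantInt → ℓ ∈ P)
    (C e k : ℕ → ℕ) (he : ∀ ℓ ∈ P, ¬ 2 ^ (e ℓ + 4) ∣ ℓ ^ 2 - 1)
    (hC : ∀ (ℓ : ℕ) [Fact ℓ.Prime], ℓ ∈ P →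
      4 ≤ C ℓ ∨ (W.HasMultiplicativeReductionAtPrime ℓ ∧ 2 ≤ C ℓ) ∨
        (W.HasMultiplicativeReductionAtPrime ℓ ∧ (ℓ : ℤ) ^ k ℓ ∣ W.minimalDiscriminantInt ∧
          ¬ (ℓ : ℤ) ^ (k ℓ + 1) ∣ W.minimalDiscriminantInt ∧ ¬ 2 ∣ k ℓ ∧ 1 ≤ C ℓ) ∨
        (¬ (ℓ : ℤ) ∣ W.minimalDiscriminantInt ∧ 1 ≤ C ℓ))
    (hlow : ∀ κ : ZpExtension ℚ 2, κ.IsCyclotomic →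
      2 ^ a ≤ Nat.card {z : W.selmerLayer κ 0 // 2 • z = 0})
    (hup : ∀ κ : ZpExtension ℚ 2, κ.IsCyclotomic →
      Nat.card {z : W.selmerLayer κ j' // 2 • z = 0} ≤ 2 ^ d)
    (harith : 2 ^ (d + t) * 2 * ∏ ℓ ∈ P, C ℓ ^ 2 ^ min j' (e ℓ) < 2 ^ (2 ^ j' - 1 + a)) :
    TowerGapAtTwo W :=
  MultTowerTorsion.towerGapAtTwo_of_layerSelmer_cert_splitTwo_oneBit_of_goodPrime_kernel W lemma33_localTowerKerPrimary_eq_bot_of_good_holds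
    lemma33_localTowerKerPrimary_cyclic_of_multiplicative_holds lemma33_natCard_localTowerKerPrimary_le_four_of_additive_holds
    hsplit finite_torsion_cyclotomicZpExtension_holds ℓ₀ h3 hgood hn hndvd P hP hΔ C e k he hC hlow hup harith

/-- **TOWER gap at a SPLIT multiplicative `2` with Tate unit `≡ ±3 (mod 8)`, ZERO bits, any rational torsion, every local binder discharged**:
torsion count from a good prime `ℓ₀ ≥ 3`, layer counts at `0 ≤ j'`, arithmetic `2^{d+t} · ∏_{ℓ∈P} C_ℓ^{2^{min(j', e_ℓ)}} < 2^{2^{j'} − 1 + a}`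
(= `MultTowerTorsion.towerGapAtTwo_of_layerSelmer_cert_splitTwo_zeroBit_of_goodPrime_kernel` fed with the Lemma-3.3 theorems and
`Greenberg1999.finite_torsion_cyclotomicZpExtension_holds`).
[cite: GreenbergLNM1716, §1 p. 62, §3 pp. 85–94, §4 Lemma 4.3] [cite: SilvermanAEC2009, VII.3 Prop. 3.1(b), VII.5.1]
[cite: Ribet1981KatzLangAppendix, Theorem (p. 315)] -/
theorem towerGapAtTwo_of_layerSelmer_cert_splitTwo_zeroBit_of_goodPrime
    (hsplit : W.HasSplitMultiplicativeReductionAtPrime 2)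
    (htu : ∃ (k : ℕ) (u c : ℤ), W.minimalDiscriminantInt = 2 ^ k * u ∧ W.c₄ = (c : ℚ) ∧ (u * c % 8 = 3 ∨ u * c % 8 = 5))
    (ℓ₀ : ℕ) [Fact ℓ₀.Prime] (h3 : 3 ≤ ℓ₀) (hgood : W.HasGoodReductionAtPrime ℓ₀) {t n : ℕ}
    (hn : W.reductionPointCount ℓ₀ = n) (hndvd : ¬ 2 ^ (t + 1) ∣ n) {j' a d : ℕ}
    (P : Finset ℕ) (hP : ∀ ℓ ∈ P, ℓ.Prime ∧ ℓ ≠ 2)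
    (hΔ : ∀ ℓ : ℕ, ℓ.Prime → ℓ ≠ 2 → (ℓ : ℤ) ∣ W.minimalDiscriminantInt → ℓ ∈ P)
    (C e k : ℕ → ℕ) (he : ∀ ℓ ∈ P, ¬ 2 ^ (e ℓ + 4) ∣ ℓ ^ 2 - 1)
    (hC : ∀ (ℓ : ℕ) [Fact ℓ.Prime], ℓ ∈ P →
      4 ≤ C ℓ ∨ (W.HasMultiplicativeReductionAtPrime ℓ ∧ 2 ≤ C ℓ) ∨
        (W.HasMultiplicativeReductionAtPrime ℓ ∧ (ℓ : ℤ) ^ k ℓ ∣ W.minimalDiscriminantInt ∧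
          ¬ (ℓ : ℤ) ^ (k ℓ + 1) ∣ W.minimalDiscriminantInt ∧ ¬ 2 ∣ k ℓ ∧ 1 ≤ C ℓ) ∨
        (¬ (ℓ : ℤ) ∣ W.minimalDiscriminantInt ∧ 1 ≤ C ℓ))
    (hlow : ∀ κ : ZpExtension ℚ 2, κ.IsCyclotomic →
      2 ^ a ≤ Nat.card {z : W.selmerLayer κ 0 // 2 • z = 0})
    (hup : ∀ κ : ZpExtension ℚ 2, κ.IsCyclotomic →
      Nat.card {z : W.selmerLayer κ j' // 2 • z = 0} ≤ 2 ^ d)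
    (harith : 2 ^ (d + t) * ∏ ℓ ∈ P, C ℓ ^ 2 ^ min j' (e ℓ) < 2 ^ (2 ^ j' - 1 + a)) :
    TowerGapAtTwo W :=
  MultTowerTorsion.towerGapAtTwo_of_layerSelmer_cert_splitTwo_zeroBit_of_goodPrime_kernel W lemma33_localTowerKerPrimary_eq_bot_of_good_holds
    lemma33_localTowerKerPrimary_cyclic_of_multiplicative_holds lemma33_natCard_localTowerKerPrimary_le_four_of_additive_holds
    hsplit htu finite_torsion_cyclotomicZpExtension_holds ℓ₀ h3 hgood hn hndvd P hP hΔ C e k he hC hlow hup harith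

end Summit.BirchSwinnertonDyer.BirchSwinnertonDyer.Theorems.MultTowerKernel

end
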